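import Summits.QuantumFields.QCD.Theses.NestedDissectionSea
import Summits.QuantumFields.QCD.Theorems.CoerciveSea.Negative.PinWindow
import Summits.QuantumFields.QCD.Theorems.NestedDissectionSeaKineticEdge
import Literature.MathematicalPhysics.QuantumFieldTheory.QCDPhaseQuenched

/-!
# Crux `CoerciveSea` (stmt-QuantumFields-13901), line `chirality-collapses-pseudospectrum` —
# SMALL BOXES ARE NOT CONTENT: on the physical branch the separator law holds deterministically below any fixed size

Helper file of the kept line lead (c1) for skeleton v4 of the line (`Cruxes/CoerciveSea/Lines/
chirality_collapses_pseudospectrum.lean`). Clause (i) of the crux asks, for every roughly cubic corner-`0` window box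
`s` (`b₀ ≤ s_i`, `s_i ≤ 2 s_j`), `P_pq(HasSingularSeparator U m_f(k) s (t/s₀)) ≤ C t^α` for `t ∈ (0,1]`. This file
proves that part of it OUTRIGHT for the boxes with a side below any fixed `S₁`, once the valence mass is above
`−κ₀/2`, `κ₀ = 4(1 − cos(π/2S₁))` — which on the physical branch (`mcrit k → 0`, `a_k/Z_m k → 0`) holds eventually in
`k` for every flavour (`tendsto_valenceMass`):

* `kineticFloor_lt_sum`, `kineticFloor_pos` — a roughly cubic box with a side `< S₁` has all sides `< 2S₁`, hence
  kinetic floor `Σ_i (1 − cos(π/s_i)) > κ₀ > 0` (cosine strictly decreasing on `[0, π]`);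
* `ratio_le_of_forall_not`, `ratio_le_of_one_le` — the crux's weighted ratio of Bochner integrals is `0` on an empty
  event and `≤ 1` on ANY event (non-negative integrable weight; no measurability needed);
* `one_le_mul_rpow_of_le` — `1 ≤ C t^α` for `t ≥ κ₀` when `C ≥ κ₀^{−α}`;
* `tendsto_valenceMass` — `mcrit k + a_k m_f/Z_m k → 0` from `mcrit → 0` and landed
  `CoerciveSeaNegative.tendsto_a_div_Zm` (`HasMassScaling`, `N_f ≤ 16`);
* `smallBox_separatorLaw` (registered stub of the crux item) — THE SMALL-BOX HALF OF CLAUSE (i): for a box with a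
  side `< S₁`, all sides in `[2, N]`, roughly cubic, valence mass `> −κ₀/2`, any `t > 0`, `α > 0`, `C ≥ κ₀^{−α}`:
  `P_pq(HasSingularSeparator U (mq f) s (t/s₀)) ≤ C t^α` — for `t ≤ κ₀` the event is EMPTY by the landed kinetic
  edge (b) (`KineticEdge.kineticEdge_separator`: a `τ`-singular separator forces `Σ(1 − cos) < τ − μ`, while
  `τ = t/s₀ ≤ t/2 ≤ κ₀/2` and `−μ < κ₀/2`), for `t > κ₀` the ratio is `≤ 1 ≤ κ₀^{−α} t^α`.

Consequence (used by the skeleton's sorry-free composition `CoerciveSea_of`): the A″/B″ laws of the line need only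
be asked on boxes with ALL sides `≥ S₀`, for an `S₀` their prover chooses; every small-box atom of the v3 laws (the
one-site box at the central doubler mass `μ = −4`, `stub5_oneSite_event_neg_four`) disappears on the physical branch.
[folklore]
-/

noncomputable section

open scoped BigOperators Classical
open MeasureTheory Filter Matrix
open Literature.MathematicalPhysics.QuantumLattice Literature.MathematicalPhysics.QuantumFieldTheory
  Literature.Probability.LatticeModels
open Summit.QuantumFields.QCD.Theorems.CoerciveSeaNegative (tendsto_a_div_Zm massExponent_pos)
open Summit.QuantumFields.QCD.Theorems.KineticEdge (kineticEdge_separator)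

namespace Summit.QuantumFields.QCD.Cruxes.CoerciveSea.ChiralityCollapsesPseudospectrum

/-- Above a positive floor `κ₀ ≤ t` a power law with constant `≥ κ₀^{−α}` dominates `1`: `1 ≤ C t^α`. -/
theorem one_le_mul_rpow_of_le {κ₀ t α C : ℝ} (hκ₀ : 0 < κ₀) (hκt : κ₀ ≤ t) (hα : 0 < α)
    (hC : κ₀ ^ (-α) ≤ C) : 1 ≤ C * t ^ α := by
  have h1 : κ₀ ^ (-α) * κ₀ ^ α = 1 := by
    rw [Real.rpow_neg hκ₀.le, inv_mul_cancel₀ (Real.rpow_pos_of_pos hκ₀ α).ne']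
  have h2 : κ₀ ^ α ≤ t ^ α := Real.rpow_le_rpow hκ₀.le hκt hα.le
  calc (1 : ℝ) = κ₀ ^ (-α) * κ₀ ^ α := h1.symm
    _ ≤ C * t ^ α := mul_le_mul hC h2 (Real.rpow_nonneg hκ₀.le α)
        ((Real.rpow_nonneg hκ₀.le _).trans hC)

/-- **Kinetic floor of a small roughly cubic box.** If some side of `s` is `< S₁` (`S₁ ≥ 1`), all sides are `≥ 2` and
`s_i ≤ 2 s_j`, then every side is `< 2S₁`, so each direction contributes more than `1 − cos(π/(2S₁))` to the kinetic
edge: `4(1 − cos(π/(2S₁))) < Σ_i (1 − cos(π/s_i))`. -/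
theorem kineticFloor_lt_sum {S₁ : ℕ} (hS₁ : 1 ≤ S₁) (s : Fin 4 → ℕ) (h2 : ∀ i, 2 ≤ s i)
    (hcub : ∀ i j, s i ≤ 2 * s j) (hsmall : ∃ i, s i < S₁) :
    4 * (1 - Real.cos (Real.pi / (2 * S₁))) < ∑ i, (1 - Real.cos (Real.pi / s i)) := by
  obtain ⟨i₀, hi₀⟩ := hsmall
  have hlt : ∀ i, s i < 2 * S₁ := fun i => lt_of_le_of_lt (hcub i i₀) (by omega)
  have hterm : ∀ i, 1 - Real.cos (Real.pi / (2 * S₁)) < 1 - Real.cos (Real.pi / s i) := by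
    intro i
    have hsi : (0 : ℝ) < s i := by exact_mod_cast (lt_of_lt_of_le (by norm_num : (0 : ℕ) < 2) (h2 i))
    have hS : (0 : ℝ) < 2 * S₁ := by exact_mod_cast (by omega : 0 < 2 * S₁)
    have hx0 : 0 ≤ Real.pi / (2 * S₁) := div_nonneg Real.pi_pos.le hS.le
    have hyπ : Real.pi / s i ≤ Real.pi := by
      rw [div_le_iff₀ hsi]
      have h1 : (1 : ℝ) ≤ s i := by exact_mod_cast (le_trans (by norm_num) (h2 i))
      nlinarith [Real.pi_pos]
    have hxy : Real.pi / (2 * S₁) < Real.pi / s i := by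
      apply div_lt_div_of_pos_left Real.pi_pos hsi
      exact_mod_cast hlt i
    have := Real.cos_lt_cos_of_nonneg_of_le_pi hx0 hyπ hxy
    linarith
  calc 4 * (1 - Real.cos (Real.pi / (2 * S₁)))
      = ∑ _i : Fin 4, (1 - Real.cos (Real.pi / (2 * S₁))) := by
        rw [Finset.sum_const, Finset.card_univ, Fintype.card_fin, nsmul_eq_mul]
        norm_num
    _ < ∑ i, (1 - Real.cos (Real.pi / s i)) :=
        Finset.sum_lt_sum_of_nonempty Finset.univ_nonempty fun i _ => hterm i

/-- The kinetic floor is positive: `0 < 4(1 − cos(π/(2S₁)))` for `S₁ ≥ 1`. -/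
theorem kineticFloor_pos {S₁ : ℕ} (hS₁ : 1 ≤ S₁) : 0 < 4 * (1 - Real.cos (Real.pi / (2 * S₁))) := by
  have hS : (0 : ℝ) < 2 * S₁ := by exact_mod_cast (by omega : 0 < 2 * S₁)
  have hx0 : 0 < Real.pi / (2 * S₁) := div_pos Real.pi_pos hS
  have hxπ : Real.pi / (2 * S₁) ≤ Real.pi := by
    rw [div_le_iff₀ hS]
    have h1 : (1 : ℝ) ≤ 2 * S₁ := by exact_mod_cast (by omega : 1 ≤ 2 * S₁)
    nlinarith [Real.pi_pos]
  have h := Real.cos_lt_cos_of_nonneg_of_le_pi le_rfl hxπ hx0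
  rw [Real.cos_zero] at h
  linarith

/-- **On the physical branch every valence mass tends to `0`** in lattice units: `mcrit k → 0` and
`a_k/Z_m k → 0` (`HasMassScaling`, `N_f ≤ 16`, landed `CoerciveSeaNegative.tendsto_a_div_Zm`) give
`mcrit k + a_k m_f/Z_m k → 0`. -/
theorem tendsto_valenceMass {Nf : ℕ} (reg : QCDRegularisation Nf) (hms : reg.HasMassScaling) (hNf : Nf ≤ 16)
    (hcrit : Tendsto reg.mcrit atTop (nhds 0)) (m : Fin Nf → ℝ) (f : Fin Nf) :
    Tendsto (fun k => reg.mcrit k + reg.a k * m f / reg.Zm k) atTop (nhds 0) := by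
  have h := (tendsto_a_div_Zm reg hms (massExponent_pos hNf)).mul_const (m f)
  rw [zero_mul] at h
  have h2 := hcrit.add h
  rw [add_zero] at h2
  exact h2.congr fun k => by ring

/-- **Ratio of an empty event.** If the event never happens, its weighted ratio is `≤` any non-negative bound
(it is `0/Z`, or the Bochner junk `0`). -/
theorem ratio_le_of_forall_not {Ω : Type*} [MeasurableSpace Ω] (μ : Measure Ω) (wt : Ω → ℝ)
    (E : Ω → Prop) (hE : ∀ U, ¬ E U) {B : ℝ} (hB : 0 ≤ B) :
    (∫ U, (if E U then (1 : ℝ) else 0) * wt U ∂μ) / (∫ U, wt U ∂μ) ≤ B := by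
  have h0 : (fun U => (if E U then (1 : ℝ) else 0) * wt U) = fun _ => 0 := by
    funext U
    rw [if_neg (hE U), zero_mul]
  rw [h0, integral_zero, zero_div]
  exact hB

/-- **A weighted ratio never exceeds `1`** (non-negative integrable weight, ANY event — measurable or not): the
numerator is `≤` the normaliser by monotonicity of the Bochner integral against a non-negative integrand, and the
conventions `x/0 = 0`, `∫(non-integrable) = 0` only help. Hence it is `≤` any bound `≥ 1`. -/
theorem ratio_le_of_one_le {Ω : Type*} [MeasurableSpace Ω] (μ : Measure Ω) (wt : Ω → ℝ)
    (hwt0 : ∀ U, 0 ≤ wt U) (hwti : Integrable wt μ) (E : Ω → Prop) {B : ℝ} (hB : 1 ≤ B) :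
    (∫ U, (if E U then (1 : ℝ) else 0) * wt U ∂μ) / (∫ U, wt U ∂μ) ≤ B := by
  have hnum : ∫ U, (if E U then (1 : ℝ) else 0) * wt U ∂μ ≤ ∫ U, wt U ∂μ := by
    refine integral_mono_of_nonneg (Eventually.of_forall fun U => ?_) hwti (Eventually.of_forall fun U => ?_)
    · show (0 : ℝ) ≤ (if E U then (1 : ℝ) else 0) * wt U
      exact mul_nonneg (by split_ifs <;> norm_num) (hwt0 U)
    · show (if E U then (1 : ℝ) else 0) * wt U ≤ wt U
      split_ifs
      · rw [one_mul]
      · rw [zero_mul]; exact hwt0 U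
  refine le_trans ?_ hB
  rcases (integral_nonneg fun U => hwt0 U : (0 : ℝ) ≤ ∫ U, wt U ∂μ).eq_or_lt with hZ | hZ
  · rw [← hZ, div_zero]; exact zero_le_one
  · rwa [div_le_one hZ]


/-- **The small-box half of clause (i)** (registered stub `smallBox_separatorLaw` of crux stmt-QuantumFields-13901).
On the torus of side `N`, at coupling `β`, with weight masses `mq`, for a corner-`0` box `s` with some side `< S₁`
(`S₁ ≥ 1`), all sides in `[2, N]`, roughly cubic (`s_i ≤ 2 s_j`), a flavour `f` whose valence mass exceeds `−κ₀/2`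
(`κ₀ = 4(1 − cos(π/2S₁))`), any `t > 0`, `α > 0` and `C ≥ κ₀^{−α}`: the phase-quenched probability of a
`t/s₀`-singular separator is `≤ C t^α` — VERBATIM the crux's ratio of Bochner integrals against
`wilsonMeasure (fundamentalRep (Fin 3)) β`. Proof: kinetic floor `> κ₀` (`kineticFloor_lt_sum`); for `t ≤ κ₀` the
event is empty by `KineticEdge.kineticEdge_separator` (`τ = t/s₀ ≤ t/2`), ratio `0`; for `t > κ₀`,
ratio `≤ 1 ≤ κ₀^{−α}t^α ≤ C t^α`. [folklore] -/
theorem smallBox_separatorLaw :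
    ∀ (Nf N : ℕ) [NeZero N] (β : ℝ) (mq : Fin Nf → ℝ) (s : Fin 4 → ℕ) (S₁ : ℕ) (C α t : ℝ) (f : Fin Nf),
      1 ≤ S₁ → (∃ i, s i < S₁) → (∀ i, 2 ≤ s i ∧ s i ≤ N) → (∀ i j, s i ≤ 2 * s j) →
      -(4 * (1 - Real.cos (Real.pi / (2 * S₁))) / 2) < mq f → 0 < t → 0 < α →
      (4 * (1 - Real.cos (Real.pi / (2 * S₁)))) ^ (-α) ≤ C →
      (∫ U : GaugeConfig 4 N (Matrix.specialUnitaryGroup (Fin 3) ℂ), (if HasSingularSeparator U (mq f) s (t / s 0) then (1 : ℝ) else 0) * ∏ f', ‖fermionDet (wilsonDirac (fundamentalRep (Fin 3)) U (mq f') 1)‖ ∂(wilsonMeasure (fundamentalRep (Fin 3)) β)) /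
        (∫ U : GaugeConfig 4 N (Matrix.specialUnitaryGroup (Fin 3) ℂ), ∏ f', ‖fermionDet (wilsonDirac (fundamentalRep (Fin 3)) U (mq f') 1)‖ ∂(wilsonMeasure (fundamentalRep (Fin 3)) β)) ≤ C * t ^ α := by
  intro Nf N _ β mq s S₁ C α t f hS₁ hsmall hs hcub hmq ht hα hC
  set κ₀ : ℝ := 4 * (1 - Real.cos (Real.pi / (2 * S₁))) with hκ₀
  have hκ₀pos : 0 < κ₀ := kineticFloor_pos hS₁
  have h2s : ∀ i, 2 ≤ s i := fun i => (hs i).1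
  have hsN : ∀ i, s i ≤ N := fun i => (hs i).2
  have hs0 : (0 : ℝ) < (s 0 : ℝ) := by
    exact_mod_cast (lt_of_lt_of_le (by norm_num : (0 : ℕ) < 2) (h2s 0))
  have hτ : 0 < t / (s 0 : ℝ) := div_pos ht hs0
  have htα : 0 ≤ t ^ α := Real.rpow_nonneg ht.le _
  have hCnn : 0 ≤ C := (Real.rpow_nonneg hκ₀pos.le _).trans hC
  have hfloor : κ₀ < ∑ i, (1 - Real.cos (Real.pi / s i)) := kineticFloor_lt_sum hS₁ s h2s hcub hsmall
  by_cases htk : t ≤ κ₀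
  · -- the separator event is EMPTY (kinetic edge (b)), probability `0`
    refine ratio_le_of_forall_not _ _ _ (fun U hU => ?_) (mul_nonneg hCnn htα)
    have hke := kineticEdge_separator U s (mq f) (t / (s 0 : ℝ)) hτ.le hsN hU
    have ht2 : t / (s 0 : ℝ) ≤ t / 2 :=
      div_le_div_of_nonneg_left ht.le (by norm_num) (by exact_mod_cast h2s 0)
    linarith
  · -- `t > κ₀`: the ratio is `≤ 1 ≤ κ₀^{−α} t^α ≤ C t^α`
    push Not at htk
    have hwt0 : ∀ U : GaugeConfig 4 N (Matrix.specialUnitaryGroup (Fin 3) ℂ),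
        0 ≤ ∏ f', ‖fermionDet (wilsonDirac (fundamentalRep (Fin 3)) U (mq f') 1)‖ :=
      fun U => Finset.prod_nonneg fun _ _ => norm_nonneg _
    have hwti : Integrable (fun U : GaugeConfig 4 N (Matrix.specialUnitaryGroup (Fin 3) ℂ) =>
        ∏ f', ‖fermionDet (wilsonDirac (fundamentalRep (Fin 3)) U (mq f') 1)‖)
        (wilsonMeasure (d := 4) (L := N) (fundamentalRep (Fin 3)) β) := by
      simpa only [norm_det_diracMatrix] using integrable_norm_det_diracMatrix (S := N) mq
        (wilsonMeasure (d := 4) (L := N) (fundamentalRep (Fin 3)) β)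
    exact ratio_le_of_one_le _ _ hwt0 hwti _ (one_le_mul_rpow_of_le hκ₀pos htk.le hα hC)

end Summit.QuantumFields.QCD.Cruxes.CoerciveSea.ChiralityCollapsesPseudospectrum

end
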